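import Literature.NumberTheory.EllipticCurves.PadicPointsHomFiltrationProofs
import Literature.NumberTheory.EllipticCurves.FormalGroupDictionaryProofs
import Mathlib.Algebra.Polynomial.EraseLead
import Mathlib.Algebra.Polynomial.Derivative
import HarnessLib

/-!
# The linear term at `O` of a `p`-adic homomorphism given by an `x`-formula `x' = a(x)/b(x)`

Topic `NumberTheory/EllipticCurves`; a proofs-only file (theorems only: no definitions, no named
facts), part of step (V) at the finite places of the proof of Milne, *Arithmetic Duality
Theorems*, Thm. I.7.3 (isogeny invariance of the Birch–Swinnerton-Dyer quotient; the named fact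
`WeierstrassCurve.bsdRHS_eq_of_isIsogenous`).  Milne (p. 98) computes, for an isogeny
`f : A → B` over `K_v`, `z(f(K_v)) = μ_v(A, f^*ω_B)/μ_v(B, ω_B)`; for elliptic curves over `ℚ_p`
the tree reaches this number through the formal filtration (`PadicFiltrationLinearTermProofs`:
an additive map with `‖z'(f P) - k z(P)‖ ≤ C ‖z(P)‖²` near `O` maps `E⁽ᴺ⁾` onto `E'⁽ᴺ⁺ᵛ⁽ᵏ⁾⁾`).
This file supplies that estimate for maps of the shape an isogeny has on `ℚ_p`-points.

**Setting.** `E, E'` elliptic curves over `ℚ_p` with `p`-integral equations `W, W'`;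
`f : E(ℚ_p) → E'(ℚ_p)` ANY additive map; `a, b ∈ ℚ_p[X]`, `k ∈ ℚ_p^×`; and off a finite set of
points `f(x, y) = (a(x)/b(x), y')` with
`k (2y' + a₁'x' + a₃') = (2y + a₁x + a₃) · (a'b - ab')(x)/b(x)²`
— the `x`-formula of an isogeny (Silverman, *AEC*, III.4 Remark 4.13.3; the tree's
`Isogeny.exists_xy_apply_eq_eval_map_div`) together with the identity `ψ^*ω' = k ω` written as
`k · (2y' + a₁'x' + a₃') ∘ ψ = δ(x' ∘ ψ)`, `δ = d/ω` the invariant derivation (*AEC* III.5; the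
tree's coordinate identity of `IsogenyRealPeriodProofs`).

**Result** (`WeierstrassCurve.PadicXFormula.exists_linearTerm`): there are `N₀` and `C` with
`f P ∈ E'₁(ℚ_p)` and `‖z'(f P) - k z(P)‖ ≤ C ‖z(P)‖²` for all `P ∈ E⁽ᴺ⁰⁾(ℚ_p)` — the hypothesis
of `WeierstrassCurve.exists_map_formalFiltration_eq_of_linearTerm`.  This is the elementary
content of "an isogeny acts on the formal groups by a power series `kT + O(T²)`, `k` its
multiplier on invariant differentials" (*AEC* IV.4, Cor. 4.3), obtained here without power
series:

* `norm_eval_le`, `norm_eval_sub_lead_le`, `norm_eval_derivative_sub_le`: values of polynomials at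
  `‖X‖ ≥ 1` are their leading terms up to an error smaller by a factor `‖X‖`;
* `PadicXFormula.pointwise`: at a point with `‖x‖ = t²`, `‖y‖ = t³` (`t = ‖z‖⁻¹ ≫ 1`), the
  ultrametric inequality gives `‖b(x)‖ = ‖β‖t^{2 deg b}`, `‖x'‖ = ‖α/β‖ t^{2d₁}`,
  `‖y'‖ = ‖d₁α/(kβ)‖ t^{2d₁+1}` (`d₁ = deg a - deg b`), and for `d₁ = 1` the estimate
  `‖z' - kz‖ ≤ C t⁻²` from the identity
  `z' - kz = (k[2y(E - AB) + (a₁x + a₃)E] - k²xB(a₁'A + a₃'B))/(2kB²y'y)`,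
  `A = a(x)`, `B = b(x)`, `E = x(a'b - ab')(x)`, whose numerator has no term of top order;
* `PadicXFormula.exists_linearTerm`: `deg a > deg b`, since otherwise `a/b` stays bounded near `O`
  while `f(E⁽ᴺ̃⁾) ⊆ E'⁽ᴺ'⁾` for every `N'` (`exists_map_formalFiltration_le`, file
  `PadicPointsHomFiltrationProofs`); then the equation of `E'` (`‖y'‖² = ‖x'‖³` on `E'₁`) at two
  radii forces `d₁ = 1`; the degenerate small degrees are avoided by passing to `(aX², bX²)`,
  which changes neither `a/b` nor `(a'b - ab')/b²` (`xFormula_mul_X_sq`).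

## References

* J. S. Milne, *Arithmetic Duality Theorems*, 2nd ed. (2006), Ch. I §7, proof of Thm. 7.3, p. 98.
  [MilneADT2006]
* J. H. Silverman, *The Arithmetic of Elliptic Curves*, 2nd ed., GTM 106 (2009), III.4
  (Remark 4.13.3), III.5, IV.1, IV.4 (Cor. 4.3), VII.2.2. [SilvermanAEC2009]

## Design

Theorems only (D-0026); everything over `ℚ_p`, no isogenies: the consumer
(`IsogenyPadicLinearTermProofs`) derives the hypothesis `hform` for the map on `ℚ_p`-points of an
isogeny.  Thresholds and constants are produced existentially.
-/

noncomputable section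

open scoped Classical
open Polynomial Literature.NumberTheory.EllipticCurves

namespace WeierstrassCurve

namespace PadicXFormula

variable {p : ℕ} [Fact p.Prime]

/-! ### Norm bounds for polynomial values in `ℚ_p` -/

/-- Crude bound: `‖q(X)‖ ≤ (Σ_{i ≤ m} ‖qᵢ‖) · ‖X‖ⁿ` for `‖X‖ ≥ 1`, `deg q ≤ m`, `deg q ≤ n`.
[folklore] -/
theorem norm_eval_le (q : ℚ_[p][X]) {m n : ℕ} (hm : q.natDegree ≤ m) (hn : q.natDegree ≤ n)
    {X : ℚ_[p]} (hX : 1 ≤ ‖X‖) :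
    ‖q.eval X‖ ≤ (∑ i ∈ Finset.range (m + 1), ‖q.coeff i‖) * ‖X‖ ^ n := by
  rw [Polynomial.eval_eq_sum_range' (Nat.lt_succ_of_le hm), Finset.sum_mul]
  refine (norm_sum_le _ _).trans (Finset.sum_le_sum fun i _ => ?_)
  rw [norm_mul, norm_pow]
  by_cases hi : i ≤ q.natDegree
  · exact mul_le_mul_of_nonneg_left (pow_le_pow_right₀ hX (hi.trans hn)) (norm_nonneg _)
  · rw [Polynomial.coeff_eq_zero_of_natDegree_lt (not_le.mp hi), norm_zero, zero_mul, zero_mul]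

/-- Main term and error: `‖q(X) - lead(q) X^{deg q}‖ ≤ (Σ ‖(eraseLead q)ᵢ‖) · ‖X‖^{deg q - 1}` for
`‖X‖ ≥ 1`. [folklore] -/
theorem norm_eval_sub_lead_le (q : ℚ_[p][X]) {X : ℚ_[p]} (hX : 1 ≤ ‖X‖) :
    ‖q.eval X - q.leadingCoeff * X ^ q.natDegree‖ ≤
      (∑ i ∈ Finset.range (q.natDegree + 1), ‖q.eraseLead.coeff i‖) * ‖X‖ ^ (q.natDegree - 1) := by
  have hq : q.eval X = q.eraseLead.eval X + q.leadingCoeff * X ^ q.natDegree := by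
    conv_lhs => rw [← Polynomial.eraseLead_add_C_mul_X_pow q]
    rw [Polynomial.eval_add, Polynomial.eval_mul, Polynomial.eval_C, Polynomial.eval_pow,
      Polynomial.eval_X]
  have h : q.eval X - q.leadingCoeff * X ^ q.natDegree = q.eraseLead.eval X := by rw [hq]; ring
  rw [h]
  exact norm_eval_le _ ((Polynomial.eraseLead_natDegree_le q).trans (Nat.sub_le _ _))
    (Polynomial.eraseLead_natDegree_le q) hX

/-- Main term and error for the derivative: `‖q'(X) - deg(q) lead(q) X^{deg q - 1}‖ ≤
(Σ ‖((eraseLead q)')ᵢ‖) · ‖X‖^{deg q - 2}` for `‖X‖ ≥ 1`. [folklore] -/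
theorem norm_eval_derivative_sub_le (q : ℚ_[p][X]) {X : ℚ_[p]} (hX : 1 ≤ ‖X‖) :
    ‖(derivative q).eval X - q.leadingCoeff * q.natDegree * X ^ (q.natDegree - 1)‖ ≤
      (∑ i ∈ Finset.range (q.natDegree + 1), ‖(derivative q.eraseLead).coeff i‖) *
        ‖X‖ ^ (q.natDegree - 2) := by
  have hq : (derivative q).eval X = (derivative q.eraseLead).eval X +
      q.leadingCoeff * q.natDegree * X ^ (q.natDegree - 1) := by
    conv_lhs => rw [← Polynomial.eraseLead_add_C_mul_X_pow q]
    rw [Polynomial.derivative_add, Polynomial.derivative_C_mul_X_pow, Polynomial.eval_add,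
      Polynomial.eval_mul, Polynomial.eval_C, Polynomial.eval_pow, Polynomial.eval_X]
  have h : (derivative q).eval X - q.leadingCoeff * q.natDegree * X ^ (q.natDegree - 1) =
      (derivative q.eraseLead).eval X := by rw [hq]; ring
  rw [h]
  have hdeg : (derivative q.eraseLead).natDegree ≤ q.natDegree - 2 :=
    (Polynomial.natDegree_derivative_le _).trans
      (by have := Polynomial.eraseLead_natDegree_le q; omega)
  exact norm_eval_le _ (hdeg.trans (Nat.sub_le _ _)) hdeg hX

end PadicXFormula

end WeierstrassCurve


namespace WeierstrassCurve

namespace PadicXFormula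

variable {p : ℕ} [Fact p.Prime] {W W' : WeierstrassCurve ℚ_[p]} [hW : W.IsIntegral ℤ_[p]]
  [hW' : W'.IsIntegral ℤ_[p]]

set_option maxHeartbeats 800000 in
/-- **Pointwise norms for an `x`-formula near `O`.**  Data: polynomials `a, b ∈ ℚ_p[X]` with
`2 ≤ deg b < deg a`, leading coefficients `α, β`, `d₁ = deg a - deg b`; `k ≠ 0`; an affine point
`(x, y)` of the `p`-integral curve `W` with `‖x‖ = t²`, `‖y‖ = t³`; a point `(a(x)/b(x), y')` of
the `p`-integral curve `W'` related to it by the multiplier identity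
`k (2y' + a₁'x' + a₃') = (2y + a₁x + a₃) (a'b - ab')(x)/b(x)²`.  Then for `t ≥ T` (a threshold
depending only on `a, b, k`): `‖b(x)‖ = ‖β‖ t^{2 deg b}`, `‖x'‖ = ‖α/β‖ t^{2d₁} > 1`,
`‖y'‖ = ‖d₁ α/(k β)‖ t^{2d₁+1}`, and, if `d₁ = 1`,
`‖z' - k z‖ ≤ C t⁻²` for `z = -x/y`, `z' = -x'/y'` (a constant `C` depending only on `a, b, k`).
Leading terms dominate by the ultrametric inequality; the last estimate rests on the identity
`z' - kz = (k[2y(E - AB) + (a₁x + a₃)E] - k²xB(a₁'A + a₃'B)) / (2kB²y'y)`,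
`A = a(x)`, `B = b(x)`, `E = x (a'b - ab')(x)`, in which `E - AB` has no term of top degree when
`d₁ = 1`.  This is the elementary shadow of "an isogeny acts on formal groups as `kT + O(T²)`,
`k` its multiplier on invariant differentials" (Silverman, *AEC*, IV.4; Milne, *ADT*, I.7,
p. 98). [cite: SilvermanAEC2009, IV.4 (Cor. 4.3) with IV.1] -/
theorem pointwise {a b : ℚ_[p][X]} (hd2 : 2 ≤ b.natDegree) (hab : b.natDegree < a.natDegree)
    {k : ℚ_[p]} (hk : k ≠ 0) :
    ∃ T C : ℝ, 1 ≤ T ∧ 0 ≤ C ∧ ∀ (x y y' : ℚ_[p]) (t : ℝ), T ≤ t → ‖x‖ = t ^ 2 → ‖y‖ = t ^ 3 →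
      W.toAffine.Equation x y → b.eval x ≠ 0 → y ≠ 0 →
      k * (2 * y' + W'.a₁ * (a.eval x / b.eval x) + W'.a₃) =
        (2 * y + W.a₁ * x + W.a₃) * (derivative a * b - a * derivative b).eval x / (b.eval x) ^ 2 →
      ‖b.eval x‖ = ‖b.leadingCoeff‖ * t ^ (2 * b.natDegree) ∧
      ‖a.eval x / b.eval x‖ = ‖a.leadingCoeff‖ / ‖b.leadingCoeff‖ * t ^ (2 * (a.natDegree - b.natDegree)) ∧
      1 < ‖a.eval x / b.eval x‖ ∧
      ‖y'‖ = ‖((a.natDegree - b.natDegree : ℕ) : ℚ_[p])‖ * ‖a.leadingCoeff‖ /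
          (‖k‖ * ‖b.leadingCoeff‖) * t ^ (2 * (a.natDegree - b.natDegree) + 1) ∧
      (a.natDegree = b.natDegree + 1 →
        ‖-(a.eval x / b.eval x) / y' - k * (-x / y)‖ ≤ C * t⁻¹ ^ 2) := by
  -- names
  obtain ⟨m, hm⟩ : ∃ m, b.natDegree = m + 2 := ⟨b.natDegree - 2, by omega⟩
  obtain ⟨n, hn⟩ : ∃ n, a.natDegree = m + n + 3 := ⟨a.natDegree - b.natDegree - 1, by omega⟩
  have hd₁ : a.natDegree - b.natDegree = n + 1 := by omega
  set α := a.leadingCoeff with hα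
  set β := b.leadingCoeff with hβ
  have hb0 : b ≠ 0 := by rintro rfl; simp at hd2
  have ha0 : a ≠ 0 := by rintro rfl; simp at hab
  have hα0 : α ≠ 0 := leadingCoeff_ne_zero.mpr ha0
  have hβ0 : β ≠ 0 := leadingCoeff_ne_zero.mpr hb0
  have hαpos : 0 < ‖α‖ := norm_pos_iff.mpr hα0
  have hβpos : 0 < ‖β‖ := norm_pos_iff.mpr hβ0
  have hkpos : 0 < ‖k‖ := norm_pos_iff.mpr hk
  have h2pos : 0 < ‖(2 : ℚ_[p])‖ := norm_pos_iff.mpr two_ne_zero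
  set d₁q : ℚ_[p] := ((n + 1 : ℕ) : ℚ_[p]) with hd₁q
  have hd₁q0 : d₁q ≠ 0 := Nat.cast_ne_zero.mpr (Nat.succ_ne_zero n)
  have hd₁pos : 0 < ‖d₁q‖ := norm_pos_iff.mpr hd₁q0
  -- the constants of the error terms
  set Ca : ℝ := ∑ i ∈ Finset.range (a.natDegree + 1), ‖a.eraseLead.coeff i‖ with hCa
  set Cb : ℝ := ∑ i ∈ Finset.range (b.natDegree + 1), ‖b.eraseLead.coeff i‖ with hCb
  set Ca' : ℝ := ∑ i ∈ Finset.range (a.natDegree + 1), ‖(derivative a.eraseLead).coeff i‖ with hCa'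
  set Cb' : ℝ := ∑ i ∈ Finset.range (b.natDegree + 1), ‖(derivative b.eraseLead).coeff i‖ with hCb'
  clear_value Ca Cb Ca' Cb'
  have hCa0 : 0 ≤ Ca := by rw [hCa]; exact Finset.sum_nonneg fun _ _ => norm_nonneg _
  have hCb0 : 0 ≤ Cb := by rw [hCb]; exact Finset.sum_nonneg fun _ _ => norm_nonneg _
  have hCa'0 : 0 ≤ Ca' := by rw [hCa']; exact Finset.sum_nonneg fun _ _ => norm_nonneg _
  have hCb'0 : 0 ≤ Cb' := by rw [hCb']; exact Finset.sum_nonneg fun _ _ => norm_nonneg _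
  obtain ⟨CE, hCE⟩ : ∃ CE : ℝ, CE = ‖α‖ * ‖(a.natDegree : ℚ_[p])‖ * Cb + Ca' * ‖β‖ + Ca' * Cb +
    ‖α‖ * Cb' + Ca * (‖β‖ * ‖(b.natDegree : ℚ_[p])‖) + Ca * Cb' := ⟨_, rfl⟩
  have hCE0 : 0 ≤ CE := by rw [hCE]; positivity
  obtain ⟨CAB, hCAB⟩ : ∃ CAB : ℝ, CAB = ‖α‖ * Cb + Ca * ‖β‖ + Ca * Cb := ⟨_, rfl⟩
  have hCAB0 : 0 ≤ CAB := by rw [hCAB]; positivity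
  obtain ⟨CN, hCN⟩ : ∃ CN : ℝ, CN = ‖k‖ * (CE + CAB) + ‖k‖ * (‖α‖ * ‖β‖) +
    ‖k‖ ^ 2 * (‖β‖ * ‖α‖) + ‖k‖ ^ 2 * ‖β‖ ^ 2 := ⟨_, rfl⟩
  have hCN0 : 0 ≤ CN := by rw [hCN]; positivity
  -- threshold and constant
  refine ⟨1 + (Cb / ‖β‖ + Ca / ‖α‖ + CE / (‖d₁q‖ * ‖α‖ * ‖β‖) + 1 / ‖(2 : ℚ_[p])‖ + ‖β‖ / ‖α‖ +
      ‖k‖ / (‖(2 : ℚ_[p])‖ * ‖d₁q‖)),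
    CN / (‖(2 : ℚ_[p])‖ * ‖α‖ * ‖β‖), ?_, div_nonneg hCN0 (by positivity), ?_⟩
  · have : 0 ≤ Cb / ‖β‖ + Ca / ‖α‖ + CE / (‖d₁q‖ * ‖α‖ * ‖β‖) + 1 / ‖(2 : ℚ_[p])‖ + ‖β‖ / ‖α‖ +
        ‖k‖ / (‖(2 : ℚ_[p])‖ * ‖d₁q‖) := by positivity
    linarith
  intro x y y' t hT hxt hyt3 heq hbx hy0 hform
  -- unpacking the threshold
  have hT' : Cb / ‖β‖ < t ∧ Ca / ‖α‖ < t ∧ CE / (‖d₁q‖ * ‖α‖ * ‖β‖) < t ∧ 1 / ‖(2 : ℚ_[p])‖ < t ∧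
      ‖β‖ / ‖α‖ < t ∧ ‖k‖ / (‖(2 : ℚ_[p])‖ * ‖d₁q‖) < t := by
    have h1 : 0 ≤ Cb / ‖β‖ := by positivity
    have h2 : 0 ≤ Ca / ‖α‖ := by positivity
    have h3 : 0 ≤ CE / (‖d₁q‖ * ‖α‖ * ‖β‖) := by positivity
    have h4 : 0 ≤ 1 / ‖(2 : ℚ_[p])‖ := by positivity
    have h5 : 0 ≤ ‖β‖ / ‖α‖ := by positivity
    have h6 : 0 ≤ ‖k‖ / (‖(2 : ℚ_[p])‖ * ‖d₁q‖) := by positivity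
    refine ⟨by linarith, by linarith, by linarith, by linarith, by linarith, by linarith⟩
  obtain ⟨hT1, hT2, hT3, hT4, hT5, hT6⟩ := hT'
  have ht1 : 1 ≤ t := by
    have : 0 ≤ Cb / ‖β‖ + Ca / ‖α‖ + CE / (‖d₁q‖ * ‖α‖ * ‖β‖) + 1 / ‖(2 : ℚ_[p])‖ + ‖β‖ / ‖α‖ +
        ‖k‖ / (‖(2 : ℚ_[p])‖ * ‖d₁q‖) := by positivity
    linarith
  have ht0 : 0 < t := one_pos.trans_le ht1
  -- `s = ‖x‖ = t²`
  have hs1 : 1 ≤ ‖x‖ := by rw [hxt]; exact one_le_pow₀ ht1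
  have hst : t ≤ ‖x‖ := by rw [hxt, pow_two]; exact le_mul_of_one_le_left ht0.le ht1
  have hx0 : x ≠ 0 := norm_pos_iff.mp (one_pos.trans_le hs1)
  -- conversions `c/c' < t` to `c < c' * ‖x‖`
  have conv : ∀ {c c' : ℝ}, 0 < c' → c / c' < t → c < c' * ‖x‖ := by
    intro c c' hc' h
    rw [div_lt_iff₀ hc'] at h
    calc c < t * c' := h
      _ ≤ ‖x‖ * c' := mul_le_mul_of_nonneg_right hst hc'.le
      _ = c' * ‖x‖ := mul_comm _ _
  -- the four main-term/error estimates
  set A := a.eval x with hA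
  set B := b.eval x with hB
  set A₁ := (derivative a).eval x with hA₁
  set B₁ := (derivative b).eval x with hB₁
  clear_value A B A₁ B₁
  have heA : ‖A - α * x ^ a.natDegree‖ ≤ Ca * ‖x‖ ^ (a.natDegree - 1) := by
    rw [hCa, hA]; exact norm_eval_sub_lead_le a hs1
  have heB : ‖B - β * x ^ b.natDegree‖ ≤ Cb * ‖x‖ ^ (b.natDegree - 1) := by
    rw [hCb, hB]; exact norm_eval_sub_lead_le b hs1
  have heA₁ : ‖A₁ - α * a.natDegree * x ^ (a.natDegree - 1)‖ ≤ Ca' * ‖x‖ ^ (a.natDegree - 2) := by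
    rw [hCa', hA₁]; exact norm_eval_derivative_sub_le a hs1
  have heB₁ : ‖B₁ - β * b.natDegree * x ^ (b.natDegree - 1)‖ ≤ Cb' * ‖x‖ ^ (b.natDegree - 2) := by
    rw [hCb', hB₁]; exact norm_eval_derivative_sub_le b hs1
  -- rewrite the exponents through `m, n`
  rw [hm] at heB heB₁
  rw [hn] at heA heA₁
  simp only [show m + n + 3 - 1 = m + n + 2 by omega,
    show m + n + 3 - 2 = m + n + 1 by omega, show m + 2 - 2 = m by omega,
    show m + 2 - 1 = m + 1 by omega] at heA heB heA₁ heB₁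
  have hdegA : ((a.natDegree : ℕ) : ℚ_[p]) = ((m + n + 3 : ℕ) : ℚ_[p]) := by rw [hn]
  have hdegB : ((b.natDegree : ℕ) : ℚ_[p]) = ((m + 2 : ℕ) : ℚ_[p]) := by rw [hm]
  -- norms of powers of `x`
  have hxn : ∀ j : ℕ, ‖x ^ j‖ = ‖x‖ ^ j := fun j => norm_pow x j
  -- (1) `‖B‖ = ‖β‖ s^{m+2}`
  have hmainB : ‖β * x ^ (m + 2)‖ = ‖β‖ * ‖x‖ ^ (m + 2) := by rw [norm_mul, hxn]
  have hBn : ‖B‖ = ‖β‖ * ‖x‖ ^ (m + 2) := by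
    rw [← hmainB]
    refine Padic.norm_eq_of_norm_sub_lt_right ?_
    rw [hmainB]
    calc ‖B - β * x ^ (m + 2)‖ ≤ Cb * ‖x‖ ^ (m + 1) := heB
      _ < ‖β‖ * ‖x‖ * ‖x‖ ^ (m + 1) :=
          mul_lt_mul_of_pos_right (conv hβpos hT1) (pow_pos (one_pos.trans_le hs1) _)
      _ = ‖β‖ * ‖x‖ ^ (m + 2) := by ring
  -- (2) `‖A‖ = ‖α‖ s^{m+n+3}`
  have hmainA : ‖α * x ^ (m + n + 3)‖ = ‖α‖ * ‖x‖ ^ (m + n + 3) := by rw [norm_mul, hxn]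
  have hAn : ‖A‖ = ‖α‖ * ‖x‖ ^ (m + n + 3) := by
    rw [← hmainA]
    refine Padic.norm_eq_of_norm_sub_lt_right ?_
    rw [hmainA]
    calc ‖A - α * x ^ (m + n + 3)‖ ≤ Ca * ‖x‖ ^ (m + n + 2) := heA
      _ < ‖α‖ * ‖x‖ * ‖x‖ ^ (m + n + 2) :=
          mul_lt_mul_of_pos_right (conv hαpos hT2) (pow_pos (one_pos.trans_le hs1) _)
      _ = ‖α‖ * ‖x‖ ^ (m + n + 3) := by ring
  -- error terms
  set e₃ := A - α * x ^ (m + n + 3) with he₃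
  set e₂ := B - β * x ^ (m + 2) with he₂
  set e₁ := A₁ - α * ((m + n + 3 : ℕ) : ℚ_[p]) * x ^ (m + n + 2) with he₁
  set e₄ := B₁ - β * ((m + 2 : ℕ) : ℚ_[p]) * x ^ (m + 1) with he₄
  clear_value e₁ e₂ e₃ e₄
  -- (3) `E = x (A₁ B - A B₁)` and its main term `d₁ α β x^{2m+n+5}`
  set E := x * (A₁ * B - A * B₁) with hE
  clear_value E
  have hs0 : 0 < ‖x‖ := one_pos.trans_le hs1
  have hEexp : E - d₁q * α * β * x ^ (2 * m + n + 5) =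
      x * (α * ((m + n + 3 : ℕ) : ℚ_[p]) * x ^ (m + n + 2) * e₂ + e₁ * (β * x ^ (m + 2)) + e₁ * e₂
        - α * x ^ (m + n + 3) * e₄ - e₃ * (β * ((m + 2 : ℕ) : ℚ_[p]) * x ^ (m + 1)) - e₃ * e₄) := by
    simp only [hE, he₁, he₂, he₃, he₄, hd₁q]
    push_cast
    ring
  have hEerr : ‖E - d₁q * α * β * x ^ (2 * m + n + 5)‖ ≤ CE * ‖x‖ ^ (2 * m + n + 4) := by
    rw [hEexp, norm_mul]
    have h1 : ‖α * ((m + n + 3 : ℕ) : ℚ_[p]) * x ^ (m + n + 2) * e₂‖ ≤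
        ‖α‖ * ‖(a.natDegree : ℚ_[p])‖ * Cb * ‖x‖ ^ (2 * m + n + 3) := by
      rw [norm_mul, norm_mul, norm_mul, hxn, ← hdegA]
      calc ‖α‖ * ‖(a.natDegree : ℚ_[p])‖ * ‖x‖ ^ (m + n + 2) * ‖e₂‖
          ≤ ‖α‖ * ‖(a.natDegree : ℚ_[p])‖ * ‖x‖ ^ (m + n + 2) * (Cb * ‖x‖ ^ (m + 1)) :=
            mul_le_mul_of_nonneg_left heB (by positivity)
        _ = ‖α‖ * ‖(a.natDegree : ℚ_[p])‖ * Cb * ‖x‖ ^ (2 * m + n + 3) := by ring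
    have h2 : ‖e₁ * (β * x ^ (m + 2))‖ ≤ Ca' * ‖β‖ * ‖x‖ ^ (2 * m + n + 3) := by
      rw [norm_mul, norm_mul, hxn]
      calc ‖e₁‖ * (‖β‖ * ‖x‖ ^ (m + 2)) ≤ Ca' * ‖x‖ ^ (m + n + 1) * (‖β‖ * ‖x‖ ^ (m + 2)) :=
            mul_le_mul_of_nonneg_right heA₁ (by positivity)
        _ = Ca' * ‖β‖ * ‖x‖ ^ (2 * m + n + 3) := by ring
    have h3 : ‖e₁ * e₂‖ ≤ Ca' * Cb * ‖x‖ ^ (2 * m + n + 3) := by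
      rw [norm_mul]
      calc ‖e₁‖ * ‖e₂‖ ≤ Ca' * ‖x‖ ^ (m + n + 1) * (Cb * ‖x‖ ^ (m + 1)) :=
            mul_le_mul heA₁ heB (norm_nonneg _) (by positivity)
        _ = Ca' * Cb * ‖x‖ ^ (2 * m + n + 2) := by ring
        _ ≤ Ca' * Cb * ‖x‖ ^ (2 * m + n + 3) :=
            mul_le_mul_of_nonneg_left (pow_le_pow_right₀ hs1 (by omega)) (by positivity)
    have h4 : ‖α * x ^ (m + n + 3) * e₄‖ ≤ ‖α‖ * Cb' * ‖x‖ ^ (2 * m + n + 3) := by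
      rw [norm_mul, norm_mul, hxn]
      calc ‖α‖ * ‖x‖ ^ (m + n + 3) * ‖e₄‖ ≤ ‖α‖ * ‖x‖ ^ (m + n + 3) * (Cb' * ‖x‖ ^ m) :=
            mul_le_mul_of_nonneg_left heB₁ (by positivity)
        _ = ‖α‖ * Cb' * ‖x‖ ^ (2 * m + n + 3) := by ring
    have h5 : ‖e₃ * (β * ((m + 2 : ℕ) : ℚ_[p]) * x ^ (m + 1))‖ ≤
        Ca * (‖β‖ * ‖(b.natDegree : ℚ_[p])‖) * ‖x‖ ^ (2 * m + n + 3) := by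
      rw [norm_mul, norm_mul, norm_mul, hxn, ← hdegB]
      calc ‖e₃‖ * (‖β‖ * ‖(b.natDegree : ℚ_[p])‖ * ‖x‖ ^ (m + 1))
          ≤ Ca * ‖x‖ ^ (m + n + 2) * (‖β‖ * ‖(b.natDegree : ℚ_[p])‖ * ‖x‖ ^ (m + 1)) :=
            mul_le_mul_of_nonneg_right heA (by positivity)
        _ = Ca * (‖β‖ * ‖(b.natDegree : ℚ_[p])‖) * ‖x‖ ^ (2 * m + n + 3) := by ring
    have h6 : ‖e₃ * e₄‖ ≤ Ca * Cb' * ‖x‖ ^ (2 * m + n + 3) := by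
      rw [norm_mul]
      calc ‖e₃‖ * ‖e₄‖ ≤ Ca * ‖x‖ ^ (m + n + 2) * (Cb' * ‖x‖ ^ m) :=
            mul_le_mul heA heB₁ (norm_nonneg _) (by positivity)
        _ = Ca * Cb' * ‖x‖ ^ (2 * m + n + 2) := by ring
        _ ≤ Ca * Cb' * ‖x‖ ^ (2 * m + n + 3) :=
            mul_le_mul_of_nonneg_left (pow_le_pow_right₀ hs1 (by omega)) (by positivity)
    have hsum : ‖α * ((m + n + 3 : ℕ) : ℚ_[p]) * x ^ (m + n + 2) * e₂ + e₁ * (β * x ^ (m + 2)) + e₁ * e₂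
        - α * x ^ (m + n + 3) * e₄ - e₃ * (β * ((m + 2 : ℕ) : ℚ_[p]) * x ^ (m + 1)) - e₃ * e₄‖ ≤
        CE * ‖x‖ ^ (2 * m + n + 3) := by
      have e := norm_sub_le (α * ((m + n + 3 : ℕ) : ℚ_[p]) * x ^ (m + n + 2) * e₂ +
        e₁ * (β * x ^ (m + 2)) + e₁ * e₂ - α * x ^ (m + n + 3) * e₄ -
        e₃ * (β * ((m + 2 : ℕ) : ℚ_[p]) * x ^ (m + 1))) (e₃ * e₄)
      have e' := norm_sub_le (α * ((m + n + 3 : ℕ) : ℚ_[p]) * x ^ (m + n + 2) * e₂ +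
        e₁ * (β * x ^ (m + 2)) + e₁ * e₂ - α * x ^ (m + n + 3) * e₄)
        (e₃ * (β * ((m + 2 : ℕ) : ℚ_[p]) * x ^ (m + 1)))
      have e'' := norm_sub_le (α * ((m + n + 3 : ℕ) : ℚ_[p]) * x ^ (m + n + 2) * e₂ +
        e₁ * (β * x ^ (m + 2)) + e₁ * e₂) (α * x ^ (m + n + 3) * e₄)
      have e''' := norm_add_le (α * ((m + n + 3 : ℕ) : ℚ_[p]) * x ^ (m + n + 2) * e₂ +
        e₁ * (β * x ^ (m + 2))) (e₁ * e₂)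
      have e'''' := norm_add_le (α * ((m + n + 3 : ℕ) : ℚ_[p]) * x ^ (m + n + 2) * e₂)
        (e₁ * (β * x ^ (m + 2)))
      rw [hCE]
      linarith [h1, h2, h3, h4, h5, h6, e, e', e'', e''', e'''']
    calc ‖x‖ * ‖α * ((m + n + 3 : ℕ) : ℚ_[p]) * x ^ (m + n + 2) * e₂ + e₁ * (β * x ^ (m + 2)) + e₁ * e₂
          - α * x ^ (m + n + 3) * e₄ - e₃ * (β * ((m + 2 : ℕ) : ℚ_[p]) * x ^ (m + 1)) - e₃ * e₄‖
        ≤ ‖x‖ * (CE * ‖x‖ ^ (2 * m + n + 3)) := mul_le_mul_of_nonneg_left hsum (norm_nonneg _)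
      _ = CE * ‖x‖ ^ (2 * m + n + 4) := by ring
  have hmainE : ‖d₁q * α * β * x ^ (2 * m + n + 5)‖ = ‖d₁q‖ * ‖α‖ * ‖β‖ * ‖x‖ ^ (2 * m + n + 5) := by
    rw [norm_mul, norm_mul, norm_mul, hxn]
  have hEn : ‖E‖ = ‖d₁q‖ * ‖α‖ * ‖β‖ * ‖x‖ ^ (2 * m + n + 5) := by
    rw [← hmainE]
    refine Padic.norm_eq_of_norm_sub_lt_right ?_
    rw [hmainE]
    calc ‖E - d₁q * α * β * x ^ (2 * m + n + 5)‖ ≤ CE * ‖x‖ ^ (2 * m + n + 4) := hEerr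
      _ < ‖d₁q‖ * ‖α‖ * ‖β‖ * ‖x‖ * ‖x‖ ^ (2 * m + n + 4) :=
          mul_lt_mul_of_pos_right (conv (by positivity) hT3) (pow_pos hs0 _)
      _ = ‖d₁q‖ * ‖α‖ * ‖β‖ * ‖x‖ ^ (2 * m + n + 5) := by ring
  have hcn : ‖A₁ * B - A * B₁‖ = ‖d₁q‖ * ‖α‖ * ‖β‖ * ‖x‖ ^ (2 * m + n + 4) := by
    have h := hEn
    rw [hE, norm_mul] at h
    apply mul_left_cancel₀ hs0.ne'
    rw [h]; ring
  -- (4) `ỹ = 2y + a₁ x + a₃` has norm `‖2‖ t³`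
  obtain ⟨ha₁, -, ha₃, -, -⟩ := W.norm_coeffs_le_one
  obtain ⟨ha₁', -, ha₃', -, -⟩ := W'.norm_coeffs_le_one
  have h2t : 1 < ‖(2 : ℚ_[p])‖ * t := by
    have := hT4; rw [div_lt_iff₀ h2pos] at this; linarith
  have hyn : ‖2 * y‖ = ‖(2 : ℚ_[p])‖ * t ^ 3 := by rw [norm_mul, hyt3]
  have hlin : ‖W.a₁ * x + W.a₃‖ ≤ ‖x‖ := by
    refine (Padic.nonarchimedean _ _).trans (max_le ?_ (ha₃.trans hs1))
    rw [norm_mul]; exact mul_le_of_le_one_left (norm_nonneg _) ha₁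
  have hyq : ‖2 * y + W.a₁ * x + W.a₃‖ = ‖(2 : ℚ_[p])‖ * t ^ 3 := by
    rw [← hyn]
    refine Padic.norm_eq_of_norm_sub_lt_right ?_
    rw [show 2 * y + W.a₁ * x + W.a₃ - 2 * y = W.a₁ * x + W.a₃ by ring, hyn]
    calc ‖W.a₁ * x + W.a₃‖ ≤ ‖x‖ := hlin
      _ = 1 * t ^ 2 := by rw [hxt, one_mul]
      _ < (‖(2 : ℚ_[p])‖ * t) * t ^ 2 := mul_lt_mul_of_pos_right h2t (pow_pos ht0 2)
      _ = ‖(2 : ℚ_[p])‖ * t ^ 3 := by ring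
  have hyq0 : 2 * y + W.a₁ * x + W.a₃ ≠ 0 := by
    rw [← norm_pos_iff, hyq]; positivity
  -- (5) `x' = A/B`
  have hx'n : ‖A / B‖ = ‖α‖ / ‖β‖ * t ^ (2 * (n + 1)) := by
    rw [norm_div, hAn, hBn, hxt, ← pow_mul, ← pow_mul]
    field_simp
    ring
  have hx'1 : 1 < ‖A / B‖ := by
    rw [hx'n]
    have h1 : 1 < ‖α‖ / ‖β‖ * t := by
      have := hT5; rw [div_lt_iff₀ hαpos] at this
      rw [div_mul_eq_mul_div, lt_div_iff₀ hβpos]; linarith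
    calc (1 : ℝ) < ‖α‖ / ‖β‖ * t := h1
      _ = ‖α‖ / ‖β‖ * t ^ 1 := by rw [pow_one]
      _ ≤ ‖α‖ / ‖β‖ * t ^ (2 * (n + 1)) :=
          mul_le_mul_of_nonneg_left (pow_le_pow_right₀ ht1 (by omega)) (by positivity)
  -- (6) `ỹ' = 2y' + a₁' x' + a₃'` from the multiplier identity
  have hcev : (derivative a * b - a * derivative b).eval x = A₁ * B - A * B₁ := by
    simp only [hA, hB, hA₁, hB₁, Polynomial.eval_sub, Polynomial.eval_mul]
  rw [hcev] at hform
  have hyq'eq : 2 * y' + W'.a₁ * (A / B) + W'.a₃ =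
      (2 * y + W.a₁ * x + W.a₃) * (A₁ * B - A * B₁) / B ^ 2 / k :=
    (eq_div_iff hk).mpr (by rw [mul_comm]; exact hform)
  have hyq'n : ‖2 * y' + W'.a₁ * (A / B) + W'.a₃‖ =
      ‖(2 : ℚ_[p])‖ * ‖d₁q‖ * ‖α‖ / (‖k‖ * ‖β‖) * t ^ (2 * (n + 1) + 1) := by
    rw [hyq'eq, norm_div, norm_div, norm_mul, norm_pow, hyq, hcn, hBn, hxt, ← pow_mul, ← pow_mul]
    field_simp
    ring
  -- (7) `y'`
  have hlin' : ‖W'.a₁ * (A / B) + W'.a₃‖ ≤ ‖A / B‖ := by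
    refine (Padic.nonarchimedean _ _).trans (max_le ?_ (ha₃'.trans hx'1.le))
    rw [norm_mul]; exact mul_le_of_le_one_left (norm_nonneg _) ha₁'
  have h2y' : ‖2 * y'‖ = ‖(2 : ℚ_[p])‖ * ‖d₁q‖ * ‖α‖ / (‖k‖ * ‖β‖) * t ^ (2 * (n + 1) + 1) := by
    rw [← hyq'n]
    refine Padic.norm_eq_of_norm_sub_lt_right ?_
    rw [show 2 * y' - (2 * y' + W'.a₁ * (A / B) + W'.a₃) = -(W'.a₁ * (A / B) + W'.a₃) by ring,
      norm_neg, hyq'n]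
    refine hlin'.trans_lt ?_
    rw [hx'n]
    have h1 : 1 < ‖(2 : ℚ_[p])‖ * ‖d₁q‖ / ‖k‖ * t := by
      have := hT6; rw [div_lt_iff₀ (mul_pos h2pos hd₁pos)] at this
      rw [div_mul_eq_mul_div, lt_div_iff₀ hkpos]; linarith
    calc ‖α‖ / ‖β‖ * t ^ (2 * (n + 1)) = 1 * (‖α‖ / ‖β‖ * t ^ (2 * (n + 1))) := by ring
      _ < (‖(2 : ℚ_[p])‖ * ‖d₁q‖ / ‖k‖ * t) * (‖α‖ / ‖β‖ * t ^ (2 * (n + 1))) :=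
          mul_lt_mul_of_pos_right h1 (by positivity)
      _ = ‖(2 : ℚ_[p])‖ * ‖d₁q‖ * ‖α‖ / (‖k‖ * ‖β‖) * t ^ (2 * (n + 1) + 1) := by
          field_simp; ring
  have hy'n : ‖y'‖ = ‖d₁q‖ * ‖α‖ / (‖k‖ * ‖β‖) * t ^ (2 * (n + 1) + 1) := by
    have h := h2y'
    rw [norm_mul] at h
    apply mul_left_cancel₀ h2pos.ne'
    rw [h]; ring
  have hy'0 : y' ≠ 0 := by
    rw [← norm_pos_iff, hy'n]; positivity
  -- conclusions (1)–(4)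
  rw [hd₁, hm]
  refine ⟨by rw [hBn, hxt, ← pow_mul], hx'n, hx'1, hy'n, fun hda => ?_⟩
  -- (8) the estimate when `d₁ = 1`, i.e. `n = 0`
  obtain rfl : n = 0 := by omega
  have hd₁q1 : d₁q = 1 := by rw [hd₁q]; norm_num
  simp only [hd₁q1, norm_one, one_mul, Nat.add_zero, zero_add] at hEn hEerr hAn heA hy'n hBn heB
  -- `AB` and its main term
  have hABexp : A * B - α * β * x ^ (2 * m + 5) = α * x ^ (m + 3) * e₂ + e₃ * (β * x ^ (m + 2)) + e₃ * e₂ := by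
    simp only [he₂, he₃]
    ring
  have hABerr : ‖A * B - α * β * x ^ (2 * m + 5)‖ ≤ CAB * ‖x‖ ^ (2 * m + 4) := by
    rw [hABexp]
    have h1 : ‖α * x ^ (m + 3) * e₂‖ ≤ ‖α‖ * Cb * ‖x‖ ^ (2 * m + 4) := by
      rw [norm_mul, norm_mul, hxn]
      calc ‖α‖ * ‖x‖ ^ (m + 3) * ‖e₂‖ ≤ ‖α‖ * ‖x‖ ^ (m + 3) * (Cb * ‖x‖ ^ (m + 1)) :=
            mul_le_mul_of_nonneg_left heB (by positivity)
        _ = ‖α‖ * Cb * ‖x‖ ^ (2 * m + 4) := by ring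
    have h2 : ‖e₃ * (β * x ^ (m + 2))‖ ≤ Ca * ‖β‖ * ‖x‖ ^ (2 * m + 4) := by
      rw [norm_mul, norm_mul, hxn]
      calc ‖e₃‖ * (‖β‖ * ‖x‖ ^ (m + 2)) ≤ Ca * ‖x‖ ^ (m + 2) * (‖β‖ * ‖x‖ ^ (m + 2)) :=
            mul_le_mul_of_nonneg_right heA (by positivity)
        _ = Ca * ‖β‖ * ‖x‖ ^ (2 * m + 4) := by ring
    have h3 : ‖e₃ * e₂‖ ≤ Ca * Cb * ‖x‖ ^ (2 * m + 4) := by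
      rw [norm_mul]
      calc ‖e₃‖ * ‖e₂‖ ≤ Ca * ‖x‖ ^ (m + 2) * (Cb * ‖x‖ ^ (m + 1)) :=
            mul_le_mul heA heB (norm_nonneg _) (by positivity)
        _ = Ca * Cb * ‖x‖ ^ (2 * m + 3) := by ring
        _ ≤ Ca * Cb * ‖x‖ ^ (2 * m + 4) :=
            mul_le_mul_of_nonneg_left (pow_le_pow_right₀ hs1 (by omega)) (by positivity)
    have e := norm_add_le (α * x ^ (m + 3) * e₂ + e₃ * (β * x ^ (m + 2))) (e₃ * e₂)
    have e' := norm_add_le (α * x ^ (m + 3) * e₂) (e₃ * (β * x ^ (m + 2)))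
    rw [hCAB]
    linarith [h1, h2, h3, e, e']
  have hEAB : ‖E - A * B‖ ≤ (CE + CAB) * ‖x‖ ^ (2 * m + 4) := by
    have h := norm_sub_le (E - α * β * x ^ (2 * m + 5)) (A * B - α * β * x ^ (2 * m + 5))
    rw [show E - α * β * x ^ (2 * m + 5) - (A * B - α * β * x ^ (2 * m + 5)) = E - A * B by ring] at h
    linarith [h, hEerr, hABerr]
  -- the identity for `z' - k z`
  have h20 : (2 : ℚ_[p]) ≠ 0 := two_ne_zero
  have h2le : ‖(2 : ℚ_[p])‖ ≤ 1 := by simpa using Padic.norm_int_le_one (p := p) 2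
  have hden0 : 2 * k * B ^ 2 * y' * y ≠ 0 :=
    mul_ne_zero (mul_ne_zero (mul_ne_zero (mul_ne_zero h20 hk) (pow_ne_zero _ hbx)) hy'0) hy0
  have h1 : k * B * (2 * y' * B + W'.a₁ * A + W'.a₃ * B) =
      (2 * y + W.a₁ * x + W.a₃) * (A₁ * B - A * B₁) := by
    rw [eq_div_iff (pow_ne_zero 2 hbx)] at hform
    rw [← hform]
    field_simp
  have key : -(A / B) / y' - k * (-x / y) =
      (k * (2 * y * (E - A * B) + (W.a₁ * x + W.a₃) * E) - k ^ 2 * x * B * (W'.a₁ * A + W'.a₃ * B)) /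
        (2 * k * B ^ 2 * y' * y) := by
    rw [eq_div_iff hden0]
    have h2 : (-(A / B) / y' - k * (-x / y)) * (2 * k * B ^ 2 * y' * y) =
        -2 * k * A * B * y + 2 * k ^ 2 * B ^ 2 * x * y' := by
      field_simp
      ring
    rw [h2, hE]
    linear_combination (k * x) * h1
  rw [key, norm_div]
  -- numerator
  have htpow : ∀ {i j : ℕ}, i ≤ j → t ^ i ≤ t ^ j := fun h => pow_le_pow_right₀ ht1 h
  have hEn' : ‖E‖ = ‖α‖ * ‖β‖ * t ^ (4 * m + 10) := by rw [hEn, hxt, ← pow_mul]; ring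
  have hAn' : ‖A‖ = ‖α‖ * t ^ (2 * m + 6) := by rw [hAn, hxt, ← pow_mul]; ring
  have hBn' : ‖B‖ = ‖β‖ * t ^ (2 * m + 4) := by rw [hBn, hxt, ← pow_mul]; ring
  have hEAB' : ‖E - A * B‖ ≤ (CE + CAB) * t ^ (4 * m + 8) :=
    calc ‖E - A * B‖ ≤ (CE + CAB) * ‖x‖ ^ (2 * m + 4) := hEAB
      _ = (CE + CAB) * t ^ (4 * m + 8) := by rw [hxt, ← pow_mul]; ring
  have i1 : ‖2 * y * (E - A * B)‖ ≤ (CE + CAB) * t ^ (4 * m + 11) := by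
    rw [norm_mul, hyn]
    calc ‖(2 : ℚ_[p])‖ * t ^ 3 * ‖E - A * B‖ ≤ 1 * t ^ 3 * ((CE + CAB) * t ^ (4 * m + 8)) :=
          mul_le_mul (mul_le_mul_of_nonneg_right h2le (by positivity)) hEAB' (norm_nonneg _)
            (by positivity)
      _ = (CE + CAB) * t ^ (4 * m + 11) := by ring
  have i2 : ‖(W.a₁ * x + W.a₃) * E‖ ≤ ‖α‖ * ‖β‖ * t ^ (4 * m + 12) := by
    rw [norm_mul, hEn']
    calc ‖W.a₁ * x + W.a₃‖ * (‖α‖ * ‖β‖ * t ^ (4 * m + 10))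
        ≤ ‖x‖ * (‖α‖ * ‖β‖ * t ^ (4 * m + 10)) := mul_le_mul_of_nonneg_right hlin (by positivity)
      _ = ‖α‖ * ‖β‖ * t ^ (4 * m + 12) := by rw [hxt]; ring
  have i3 : ‖x * B * (W'.a₁ * A + W'.a₃ * B)‖ ≤
      ‖β‖ * ‖α‖ * t ^ (4 * m + 12) + ‖β‖ ^ 2 * t ^ (4 * m + 12) := by
    rw [norm_mul, norm_mul, hxt, hBn']
    have hin : ‖W'.a₁ * A + W'.a₃ * B‖ ≤ ‖α‖ * t ^ (2 * m + 6) + ‖β‖ * t ^ (2 * m + 4) := by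
      refine (norm_add_le _ _).trans (add_le_add ?_ ?_)
      · rw [norm_mul, hAn']; exact mul_le_of_le_one_left (by positivity) ha₁'
      · rw [norm_mul, hBn']; exact mul_le_of_le_one_left (by positivity) ha₃'
    calc t ^ 2 * (‖β‖ * t ^ (2 * m + 4)) * ‖W'.a₁ * A + W'.a₃ * B‖
        ≤ t ^ 2 * (‖β‖ * t ^ (2 * m + 4)) * (‖α‖ * t ^ (2 * m + 6) + ‖β‖ * t ^ (2 * m + 4)) :=
          mul_le_mul_of_nonneg_left hin (by positivity)
      _ = ‖β‖ * ‖α‖ * t ^ (4 * m + 12) + ‖β‖ ^ 2 * t ^ (4 * m + 10) := by ring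
      _ ≤ ‖β‖ * ‖α‖ * t ^ (4 * m + 12) + ‖β‖ ^ 2 * t ^ (4 * m + 12) :=
          add_le_add le_rfl (mul_le_mul_of_nonneg_left
            (htpow (show 4 * m + 10 ≤ 4 * m + 12 by omega)) (sq_nonneg _))
  have hnum : ‖k * (2 * y * (E - A * B) + (W.a₁ * x + W.a₃) * E) -
      k ^ 2 * x * B * (W'.a₁ * A + W'.a₃ * B)‖ ≤ CN * t ^ (4 * m + 12) := by
    have ht11 : t ^ (4 * m + 11) ≤ t ^ (4 * m + 12) := htpow (by omega)
    have hP : ‖2 * y * (E - A * B) + (W.a₁ * x + W.a₃) * E‖ ≤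
        (CE + CAB) * t ^ (4 * m + 12) + ‖α‖ * ‖β‖ * t ^ (4 * m + 12) := by
      refine (norm_add_le _ _).trans (add_le_add (i1.trans ?_) i2)
      exact mul_le_mul_of_nonneg_left ht11 (by positivity)
    refine (norm_sub_le _ _).trans ?_
    rw [norm_mul, show k ^ 2 * x * B * (W'.a₁ * A + W'.a₃ * B) =
      k ^ 2 * (x * B * (W'.a₁ * A + W'.a₃ * B)) by ring, norm_mul, norm_pow]
    calc ‖k‖ * ‖2 * y * (E - A * B) + (W.a₁ * x + W.a₃) * E‖ +
          ‖k‖ ^ 2 * ‖x * B * (W'.a₁ * A + W'.a₃ * B)‖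
        ≤ ‖k‖ * ((CE + CAB) * t ^ (4 * m + 12) + ‖α‖ * ‖β‖ * t ^ (4 * m + 12)) +
          ‖k‖ ^ 2 * (‖β‖ * ‖α‖ * t ^ (4 * m + 12) + ‖β‖ ^ 2 * t ^ (4 * m + 12)) :=
          add_le_add (mul_le_mul_of_nonneg_left hP (norm_nonneg _))
            (mul_le_mul_of_nonneg_left i3 (by positivity))
      _ = CN * t ^ (4 * m + 12) := by rw [hCN]; ring
  -- denominator
  have hden : ‖2 * k * B ^ 2 * y' * y‖ = ‖(2 : ℚ_[p])‖ * ‖α‖ * ‖β‖ * t ^ (4 * m + 14) := by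
    rw [norm_mul, norm_mul, norm_mul, norm_mul, norm_pow, hBn', hy'n, hyt3]
    field_simp
    ring
  have htne : t ≠ 0 := ht0.ne'
  rw [hden, div_le_iff₀ (by positivity)]
  calc ‖k * (2 * y * (E - A * B) + (W.a₁ * x + W.a₃) * E) - k ^ 2 * x * B * (W'.a₁ * A + W'.a₃ * B)‖
      ≤ CN * t ^ (4 * m + 12) := hnum
    _ = CN / (‖(2 : ℚ_[p])‖ * ‖α‖ * ‖β‖) * t⁻¹ ^ 2 * (‖(2 : ℚ_[p])‖ * ‖α‖ * ‖β‖ * t ^ (4 * m + 14)) := by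
        field_simp
        ring

end PadicXFormula

end WeierstrassCurve

namespace WeierstrassCurve

namespace PadicXFormula

variable {p : ℕ} [Fact p.Prime] {W W' : WeierstrassCurve ℚ_[p]} [hW : W.IsIntegral ℤ_[p]]
  [hW' : W'.IsIntegral ℤ_[p]]

omit hW hW' in
/-- Transport of the nonsingularity proof in `Affine.Point.some` along equal coordinates.
[folklore] -/
theorem exists_point_eq_some {V : WeierstrassCurve ℚ_[p]} {P : V.toAffine.Point} {u v u' v' : ℚ_[p]}
    {h : V.toAffine.Nonsingular u v} (hP : P = .some u v h) (hu : u = u') (hv : v = v') :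
    ∃ h', P = .some u' v' h' := by
  subst hu hv
  exact ⟨h, hP⟩

omit hW hW' in
/-- Replacing `(a, b)` by `(a X², b X²)` changes neither `a(x)/b(x)` nor `(a'b - ab')(x)/b(x)²`
(at `x ≠ 0`). [folklore] -/
theorem xFormula_mul_X_sq (a b : ℚ_[p][X]) {x : ℚ_[p]} (hx : x ≠ 0) (hb : b.eval x ≠ 0) :
    (a * X ^ 2).eval x / (b * X ^ 2).eval x = a.eval x / b.eval x ∧
    (derivative (a * X ^ 2) * (b * X ^ 2) - (a * X ^ 2) * derivative (b * X ^ 2)).eval x /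
        ((b * X ^ 2).eval x) ^ 2 =
      (derivative a * b - a * derivative b).eval x / (b.eval x) ^ 2 := by
  have hx2 : x ^ 2 ≠ 0 := pow_ne_zero 2 hx
  constructor
  · simp only [Polynomial.eval_mul, Polynomial.eval_pow, Polynomial.eval_X]
    rw [mul_div_mul_right _ _ hx2]
  · have hd : ∀ q : ℚ_[p][X], (derivative (q * X ^ 2)).eval x =
        (derivative q).eval x * x ^ 2 + q.eval x * (2 * x) := by
      intro q
      rw [Polynomial.derivative_mul, Polynomial.derivative_X_pow]
      simp only [Polynomial.eval_add, Polynomial.eval_mul, Polynomial.eval_C, Polynomial.eval_pow,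
        Polynomial.eval_X, show (2 : ℕ) - 1 = 1 from rfl, pow_one, Nat.cast_ofNat]
    simp only [Polynomial.eval_sub, Polynomial.eval_mul, hd, Polynomial.eval_pow, Polynomial.eval_X]
    field_simp
    ring

omit hW' in
/-- Norms at a point of `E₁(ℚ_p)`: if `‖x‖ > 1` on a `p`-integral equation then `y ≠ 0` and, with
`t = ‖z‖⁻¹` for `z = -x/y`, `‖x‖ = t²`, `‖y‖ = t³`. [Silverman AEC VII.2.2] [folklore] -/
theorem norm_xy_of_one_lt {x y : ℚ_[p]} (heq : W.toAffine.Equation x y) (hx : 1 < ‖x‖) :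
    y ≠ 0 ∧ -x / y ≠ 0 ∧ ‖x‖ = ‖-x / y‖⁻¹ ^ 2 ∧ ‖y‖ = ‖-x / y‖⁻¹ ^ 3 := by
  obtain ⟨hsq, hxy⟩ := W.norm_sq_eq_norm_cube heq hx
  have hx0 : 0 < ‖x‖ := one_pos.trans hx
  have hypos : 0 < ‖y‖ := hx0.trans hxy
  have hy0 : y ≠ 0 := norm_pos_iff.mp hypos
  have hz0 : -x / y ≠ 0 := div_ne_zero (neg_ne_zero.mpr (norm_pos_iff.mp hx0)) hy0
  have hz : ‖-x / y‖ = ‖x‖ / ‖y‖ := by rw [norm_div, norm_neg]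
  -- `‖y‖ = ‖x‖ · (‖y‖/‖x‖)` with `(‖y‖/‖x‖)² = ‖x‖`
  have hxne : ‖x‖ ≠ 0 := hx0.ne'
  have hratio : (‖y‖ / ‖x‖) ^ 2 = ‖x‖ := by
    rw [div_pow, hsq]; field_simp
  refine ⟨hy0, hz0, ?_, ?_⟩
  · rw [hz, inv_div, hratio]
  · rw [hz, inv_div]
    have h1 : ‖y‖ = ‖x‖ * (‖y‖ / ‖x‖) := by field_simp
    calc ‖y‖ = ‖x‖ * (‖y‖ / ‖x‖) := h1
      _ = (‖y‖ / ‖x‖) ^ 2 * (‖y‖ / ‖x‖) := by rw [hratio]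
      _ = (‖y‖ / ‖x‖) ^ 3 := by ring

variable [W.IsElliptic] [W'.IsElliptic]

set_option maxHeartbeats 800000 in
/-- **The linear term of a `p`-adic homomorphism given by an `x`-formula.**  Let
`f : E(ℚ_p) → E'(ℚ_p)` be additive (`E, E'` with `p`-integral equations) and suppose that off a
finite set of points `f(x, y) = (a(x)/b(x), y')` with
`k (2y' + a₁'x' + a₃') = (2y + a₁x + a₃)(a'b - ab')(x)/b(x)²` for fixed `a, b ∈ ℚ_p[X]` and
`k ≠ 0` (this is the shape of the map on `ℚ_p`-points of an isogeny with multiplier `k` on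
invariant differentials: `x ∘ φ = a(x)/b(x)`, `φ^*ω' = k ω`).  Then near `O`, `f` has linear term
`k` in the parameters `z = -x/y`: `‖z'(f P) - k z(P)‖ ≤ C ‖z(P)‖²` on some `E⁽ᴺ⁰⁾`, with
`f P ∈ E'₁`.  Steps: `deg a > deg b` (otherwise `a/b` is bounded near `O`, contradicting
`f(E⁽ᴺ̃⁾) ⊆ E'⁽ᴺ'⁾`, `exists_map_formalFiltration_le`); then the pointwise norms
(`PadicXFormula.pointwise`) and the equation of `E'` at two radii force `deg a = deg b + 1`,
after which the pointwise estimate applies.  Silverman, *AEC*, IV.4 (homomorphisms of formal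
groups), IV.1; Milne, *ADT*, I.7, p. 98. [cite: SilvermanAEC2009, IV.4 (Cor. 4.3) with IV.1] -/
theorem exists_linearTerm (f : W.toAffine.Point →+ W'.toAffine.Point) {a b : ℚ_[p][X]}
    {k : ℚ_[p]} (hk : k ≠ 0) {Bad : Set W.toAffine.Point} (hBad : Bad.Finite)
    (hform : ∀ (x y : ℚ_[p]) (hxy : W.toAffine.Nonsingular x y), Affine.Point.some x y hxy ∉ Bad →
      b.eval x ≠ 0 ∧ ∃ (y' : ℚ_[p]) (h' : W'.toAffine.Nonsingular (a.eval x / b.eval x) y'),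
        f (.some x y hxy) = .some _ _ h' ∧
        k * (2 * y' + W'.a₁ * (a.eval x / b.eval x) + W'.a₃) =
          (2 * y + W.a₁ * x + W.a₃) * (derivative a * b - a * derivative b).eval x / (b.eval x) ^ 2) :
    ∃ (N₀ : ℕ) (C : ℝ), ∀ P ∈ W.formalFiltration N₀, W'.IsInReductionKernel (f P) ∧
      ‖W'.formalParameter (f P) - k * W.formalParameter P‖ ≤ C * ‖W.formalParameter P‖ ^ 2 := by
  have hp1 : 1 < (p : ℝ) := by exact_mod_cast (Fact.out : p.Prime).one_lt
  have hp0 : (0 : ℝ) < p := by positivity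
  have hpQ : (p : ℚ_[p]) ≠ 0 := Nat.cast_ne_zero.mpr (Fact.out : p.Prime).ne_zero
  -- (S1) test points `Pt j` with `z = p^{j+1}`
  have hpt : ∀ j : ℕ, ∃ P : W.toAffine.Point, W.IsInReductionKernel P ∧
      W.formalParameter P = (p : ℚ_[p]) ^ (j + 1) := fun j =>
    W.exists_formalParameter_eq_p_pow (Nat.succ_pos j)
  choose Pt hPt using hpt
  have hPt_inj : Function.Injective Pt := by
    intro i j h
    have h1 := (hPt i).2
    rw [h, (hPt j).2] at h1
    have h2 := congrArg (‖·‖) h1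
    simp only [norm_pow, Padic.norm_p] at h2
    have := pow_right_injective₀ (inv_pos.mpr hp0) (inv_lt_one_of_one_lt₀ hp1).ne h2
    omega
  have hgood : ∀ j₀ : ℕ, ∃ j, j₀ ≤ j ∧ Pt j ∉ Bad := by
    intro j₀
    have hfin : (Pt ⁻¹' Bad).Finite := hBad.preimage hPt_inj.injOn
    obtain ⟨M, hM⟩ := hfin.bddAbove
    refine ⟨max j₀ (M + 1), le_max_left _ _, fun h => ?_⟩
    have := hM h
    omega
  -- coordinates of the test points
  have hPt_some : ∀ j, ∃ (x y : ℚ_[p]) (h : W.toAffine.Nonsingular x y), Pt j = .some x y h ∧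
      1 < ‖x‖ ∧ -x / y = (p : ℚ_[p]) ^ (j + 1) := by
    intro j
    obtain ⟨hker, hz⟩ := hPt j
    rcases hP : Pt j with _ | ⟨x, y, h⟩
    · rw [hP] at hz
      exact absurd (hz.symm.trans rfl : (p : ℚ_[p]) ^ (j + 1) = 0) (pow_ne_zero _ hpQ)
    · rw [hP] at hker hz
      exact ⟨x, y, h, rfl, (W.isInReductionKernel_some h).mp hker, hz⟩
  -- `b ≠ 0`
  have hb0 : b ≠ 0 := by
    obtain ⟨j₁, -, hj₁⟩ := hgood 0
    obtain ⟨x₁, y₁, h₁, hP₁, -, -⟩ := hPt_some j₁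
    intro hb
    have := (hform x₁ y₁ h₁ (hP₁ ▸ hj₁)).1
    rw [hb, Polynomial.eval_zero] at this
    exact this rfl
  -- (S0) pass to `(a X², b X²)`
  set a₂ := a * X ^ 2 with ha₂
  set b₂ := b * X ^ 2 with hb₂
  have hb₂deg : b₂.natDegree = b.natDegree + 2 := by
    rw [hb₂, Polynomial.natDegree_mul hb0 (pow_ne_zero 2 Polynomial.X_ne_zero),
      Polynomial.natDegree_X_pow]
  have hb₂0 : b₂ ≠ 0 := mul_ne_zero hb0 (pow_ne_zero 2 Polynomial.X_ne_zero)
  have hform₂ : ∀ (x y : ℚ_[p]) (hxy : W.toAffine.Nonsingular x y), Affine.Point.some x y hxy ∉ Bad →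
      1 < ‖x‖ →
      b₂.eval x ≠ 0 ∧ ∃ (y' : ℚ_[p]) (h' : W'.toAffine.Nonsingular (a₂.eval x / b₂.eval x) y'),
        f (.some x y hxy) = .some _ _ h' ∧
        k * (2 * y' + W'.a₁ * (a₂.eval x / b₂.eval x) + W'.a₃) =
          (2 * y + W.a₁ * x + W.a₃) * (derivative a₂ * b₂ - a₂ * derivative b₂).eval x /
            (b₂.eval x) ^ 2 := by
    intro x y hxy hB hx
    have hx0 : x ≠ 0 := norm_pos_iff.mp (one_pos.trans hx)
    obtain ⟨hbx, y', h', hf, hid⟩ := hform x y hxy hB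
    obtain ⟨e1, e2⟩ := xFormula_mul_X_sq a b hx0 hbx
    have hb₂x : b₂.eval x ≠ 0 := by
      rw [hb₂, Polynomial.eval_mul, Polynomial.eval_pow, Polynomial.eval_X]
      exact mul_ne_zero hbx (pow_ne_zero 2 hx0)
    obtain ⟨h'', hf''⟩ := exists_point_eq_some hf e1.symm rfl
    refine ⟨hb₂x, y', h'', hf'', ?_⟩
    simp only [ha₂, hb₂]
    rw [e1, mul_div_assoc, e2]
    rw [mul_div_assoc] at hid
    exact hid
  -- (S2) `deg a₂ > deg b₂`
  have hdeg : b₂.natDegree < a₂.natDegree := by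
    by_contra hle
    replace hle : a₂.natDegree ≤ b₂.natDegree := not_lt.mp hle
    set β := b₂.leadingCoeff with hβ
    have hβ0 : β ≠ 0 := Polynomial.leadingCoeff_ne_zero.mpr hb₂0
    have hβpos : 0 < ‖β‖ := norm_pos_iff.mpr hβ0
    set Cb : ℝ := ∑ i ∈ Finset.range (b₂.natDegree + 1), ‖b₂.eraseLead.coeff i‖ with hCb
    set Ca : ℝ := ∑ i ∈ Finset.range (a₂.natDegree + 1), ‖a₂.coeff i‖ with hCa
    have hCa0 : 0 ≤ Ca := Finset.sum_nonneg fun _ _ => norm_nonneg _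
    -- `‖a₂(x)/b₂(x)‖ ≤ Ca/‖β‖` for `‖x‖ ≥ 1`, `Cb < ‖β‖ ‖x‖`
    have hbound : ∀ x : ℚ_[p], 1 ≤ ‖x‖ → Cb < ‖β‖ * ‖x‖ → ‖a₂.eval x / b₂.eval x‖ ≤ Ca / ‖β‖ := by
      intro x hx1 hxC
      have heB := norm_eval_sub_lead_le b₂ hx1
      have hmain : ‖β * x ^ b₂.natDegree‖ = ‖β‖ * ‖x‖ ^ b₂.natDegree := by rw [norm_mul, norm_pow]
      have hBn : ‖b₂.eval x‖ = ‖β‖ * ‖x‖ ^ b₂.natDegree := by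
        rw [← hmain]
        refine Padic.norm_eq_of_norm_sub_lt_right ?_
        rw [hmain]
        calc ‖b₂.eval x - β * x ^ b₂.natDegree‖ ≤ Cb * ‖x‖ ^ (b₂.natDegree - 1) := heB
          _ < ‖β‖ * ‖x‖ * ‖x‖ ^ (b₂.natDegree - 1) :=
              mul_lt_mul_of_pos_right hxC (pow_pos (one_pos.trans_le hx1) _)
          _ = ‖β‖ * ‖x‖ ^ b₂.natDegree := by
              rw [mul_assoc, ← pow_succ', Nat.sub_add_cancel (by omega)]
      have hAle : ‖a₂.eval x‖ ≤ Ca * ‖x‖ ^ b₂.natDegree := norm_eval_le a₂ le_rfl hle hx1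
      rw [norm_div, hBn, div_le_div_iff₀ (by positivity) hβpos]
      calc ‖a₂.eval x‖ * ‖β‖ ≤ Ca * ‖x‖ ^ b₂.natDegree * ‖β‖ :=
            mul_le_mul_of_nonneg_right hAle (norm_nonneg _)
        _ = Ca * (‖β‖ * ‖x‖ ^ b₂.natDegree) := by ring
    obtain ⟨N', hN'⟩ := pow_unbounded_of_one_lt (Ca / ‖β‖) hp1
    obtain ⟨Ñ, hÑ⟩ := exists_map_formalFiltration_le f N'
    obtain ⟨j₂, hj₂⟩ := pow_unbounded_of_one_lt (Cb / ‖β‖) hp1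
    obtain ⟨j, hj, hjB⟩ := hgood (max Ñ j₂)
    obtain ⟨x, y, hxy, hP, hx1, hz⟩ := hPt_some j
    obtain ⟨hb₂x, y', h', hf, -⟩ := hform₂ x y hxy (hP ▸ hjB) hx1
    have hmem : Pt j ∈ W.formalFiltration Ñ := by
      refine ⟨(hPt j).1, ?_⟩
      rw [(hPt j).2, norm_pow, Padic.norm_p]
      exact pow_le_pow_of_le_one (inv_nonneg.mpr hp0.le) (inv_le_one_of_one_le₀ hp1.le) (by omega)
    have hfmem : f (Pt j) ∈ W'.formalFiltration N' := hÑ ⟨Pt j, hmem, rfl⟩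
    rw [hP, hf] at hfmem
    obtain ⟨hker', hz'⟩ := hfmem
    rw [W'.isInReductionKernel_some] at hker'
    rw [W'.formalParameter_some] at hz'
    have hsq := W'.norm_formalParameter_sq h'.1 hker'
    obtain ⟨-, -, hxn, -⟩ := norm_xy_of_one_lt (W := W) hxy.1 hx1
    have hxC : Cb < ‖β‖ * ‖x‖ := by
      rw [div_lt_iff₀ hβpos] at hj₂
      have hxnorm : ‖x‖ = (p : ℝ) ^ (2 * (j + 1)) := by
        rw [hxn, hz, norm_pow, Padic.norm_p, ← inv_pow, inv_inv, ← pow_mul, mul_comm]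
      calc Cb < (p : ℝ) ^ j₂ * ‖β‖ := hj₂
        _ ≤ (p : ℝ) ^ (2 * (j + 1)) * ‖β‖ :=
            mul_le_mul_of_nonneg_right (pow_le_pow_right₀ hp1.le (by omega)) hβpos.le
        _ = ‖β‖ * ‖x‖ := by rw [hxnorm, mul_comm]
    have hle' := hbound x hx1.le hxC
    have hge : (p : ℝ) ^ N' ≤ ‖a₂.eval x / b₂.eval x‖ := by
      have h4 : 0 < ‖a₂.eval x / b₂.eval x‖ := one_pos.trans hker'
      have h3 : ‖a₂.eval x / b₂.eval x‖⁻¹ ≤ (((p : ℝ)⁻¹) ^ N') ^ 2 := by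
        rw [← hsq]; exact pow_le_pow_left₀ (norm_nonneg _) hz' 2
      rw [inv_pow, inv_pow, ← pow_mul, inv_le_inv₀ h4 (by positivity)] at h3
      calc (p : ℝ) ^ N' ≤ (p : ℝ) ^ (N' * 2) := pow_le_pow_right₀ hp1.le (by omega)
        _ ≤ _ := h3
    linarith
  -- (S3) the pointwise lemma for `(a₂, b₂)`
  obtain ⟨T, C, hT1, hC0, hpw⟩ :=
    pointwise (W := W) (W' := W') (by omega : 2 ≤ b₂.natDegree) hdeg hk
  obtain ⟨jT, hjT⟩ := pow_unbounded_of_one_lt T hp1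
  -- (S4) at a good test point beyond `T`: the pointwise norms and the point of `E'`
  have hpw_at : ∀ j, jT ≤ j → Pt j ∉ Bad → ∃ (x y y' : ℚ_[p]),
      W'.toAffine.Nonsingular (a₂.eval x / b₂.eval x) y' ∧
      ‖a₂.eval x / b₂.eval x‖ = ‖a₂.leadingCoeff‖ / ‖b₂.leadingCoeff‖ *
          ((p : ℝ) ^ (j + 1)) ^ (2 * (a₂.natDegree - b₂.natDegree)) ∧
      1 < ‖a₂.eval x / b₂.eval x‖ ∧
      ‖y'‖ = ‖((a₂.natDegree - b₂.natDegree : ℕ) : ℚ_[p])‖ * ‖a₂.leadingCoeff‖ /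
          (‖k‖ * ‖b₂.leadingCoeff‖) *
            ((p : ℝ) ^ (j + 1)) ^ (2 * (a₂.natDegree - b₂.natDegree) + 1) := by
    intro j hj hjB
    obtain ⟨x, y, hxy, hP, hx1, hz⟩ := hPt_some j
    obtain ⟨hb₂x, y', h', -, hid⟩ := hform₂ x y hxy (hP ▸ hjB) hx1
    obtain ⟨hy0, -, hxn, hyn⟩ := norm_xy_of_one_lt (W := W) hxy.1 hx1
    have ht : ‖-x / y‖⁻¹ = (p : ℝ) ^ (j + 1) := by
      rw [hz, norm_pow, Padic.norm_p, ← inv_pow, inv_inv]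
    rw [ht] at hxn hyn
    have hTle : T ≤ (p : ℝ) ^ (j + 1) := hjT.le.trans (pow_le_pow_right₀ hp1.le (by omega))
    obtain ⟨-, h2, h3, h4, -⟩ := hpw x y y' _ hTle hxn hyn hxy.1 hb₂x hy0 hid
    exact ⟨x, y, y', h', h2, h3, h4⟩
  have hd1 : a₂.natDegree = b₂.natDegree + 1 := by
    obtain ⟨j, hj, hjB⟩ := hgood jT
    obtain ⟨j', hj', hjB'⟩ := hgood (j + 1)
    obtain ⟨x, y, y', hns, hx', hx'1, hy'⟩ := hpw_at j hj hjB
    obtain ⟨u, v, v', hns', hu', hu'1, hv'⟩ := hpw_at j' (by omega) hjB'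
    have e1 := (W'.norm_sq_eq_norm_cube hns.1 hx'1).1
    have e2 := (W'.norm_sq_eq_norm_cube hns'.1 hu'1).1
    rw [hy', hx'] at e1
    rw [hv', hu'] at e2
    set d₁ := a₂.natDegree - b₂.natDegree with hd₁
    set t₁ : ℝ := (p : ℝ) ^ (j + 1) with ht₁
    set t₂ : ℝ := (p : ℝ) ^ (j' + 1) with ht₂
    set c₁ : ℝ := ‖((d₁ : ℕ) : ℚ_[p])‖ * ‖a₂.leadingCoeff‖ / (‖k‖ * ‖b₂.leadingCoeff‖) with hc₁
    set c₂ : ℝ := ‖a₂.leadingCoeff‖ / ‖b₂.leadingCoeff‖ with hc₂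
    clear_value t₁ t₂ c₁ c₂
    have ha₂0 : a₂ ≠ 0 := by rintro h; rw [h, Polynomial.natDegree_zero] at hdeg; omega
    have hαpos : 0 < ‖a₂.leadingCoeff‖ :=
      norm_pos_iff.mpr (Polynomial.leadingCoeff_ne_zero.mpr ha₂0)
    have hβpos : 0 < ‖b₂.leadingCoeff‖ :=
      norm_pos_iff.mpr (Polynomial.leadingCoeff_ne_zero.mpr hb₂0)
    have hc₂pos : 0 < c₂ := by rw [hc₂]; positivity
    have ht₁pos : 0 < t₁ := by rw [ht₁]; positivity
    have ht₂pos : 0 < t₂ := by rw [ht₂]; positivity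
    have f1 : c₁ ^ 2 * t₁ ^ (4 * d₁ + 2) = c₂ ^ 3 * t₁ ^ (6 * d₁) := by
      have h := e1
      rw [mul_pow, mul_pow, ← pow_mul, ← pow_mul, show (2 * d₁ + 1) * 2 = 4 * d₁ + 2 by ring,
        show 2 * d₁ * 3 = 6 * d₁ by ring] at h
      exact h
    have f2 : c₁ ^ 2 * t₂ ^ (4 * d₁ + 2) = c₂ ^ 3 * t₂ ^ (6 * d₁) := by
      have h := e2
      rw [mul_pow, mul_pow, ← pow_mul, ← pow_mul, show (2 * d₁ + 1) * 2 = 4 * d₁ + 2 by ring,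
        show 2 * d₁ * 3 = 6 * d₁ by ring] at h
      exact h
    obtain ⟨e, he⟩ : ∃ e, 6 * d₁ = e + (4 * d₁ + 2) := ⟨2 * d₁ - 2, by omega⟩
    have hs₁ : t₁ ^ (6 * d₁) = t₁ ^ e * t₁ ^ (4 * d₁ + 2) := by rw [← pow_add, he]
    have hs₂ : t₂ ^ (6 * d₁) = t₂ ^ e * t₂ ^ (4 * d₁ + 2) := by rw [← pow_add, he]
    rw [hs₁, ← mul_assoc] at f1
    rw [hs₂, ← mul_assoc] at f2
    have g1 : c₁ ^ 2 = c₂ ^ 3 * t₁ ^ e := mul_right_cancel₀ (pow_ne_zero (4 * d₁ + 2) ht₁pos.ne') f1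
    have g2 : c₁ ^ 2 = c₂ ^ 3 * t₂ ^ e := mul_right_cancel₀ (pow_ne_zero (4 * d₁ + 2) ht₂pos.ne') f2
    have g3 : t₁ ^ e = t₂ ^ e := mul_left_cancel₀ (pow_ne_zero 3 hc₂pos.ne') (g1.symm.trans g2)
    by_contra hne
    have he0 : e ≠ 0 := by omega
    have h12 : t₁ = t₂ := (pow_left_inj₀ ht₁pos.le ht₂pos.le he0).mp g3
    rw [ht₁, ht₂] at h12
    have : j + 1 = j' + 1 := pow_right_injective₀ hp0 hp1.ne' h12
    omega
  -- (S5) thresholds: avoid `Bad` and exceed `T`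
  have hBadx : ∃ R : ℝ, ∀ (x y : ℚ_[p]) (h : W.toAffine.Nonsingular x y),
      Affine.Point.some x y h ∈ Bad → ‖x‖ ≤ R := by
    obtain ⟨R, hR⟩ := (hBad.image fun P : W.toAffine.Point =>
      match P with | 0 => (0 : ℝ) | .some x _ _ => ‖x‖).bddAbove
    exact ⟨R, fun x y h hmem => hR ⟨_, hmem, rfl⟩⟩
  obtain ⟨R, hR⟩ := hBadx
  obtain ⟨N₀, hN₀⟩ := pow_unbounded_of_one_lt (max R T) hp1
  refine ⟨N₀, C, fun P hP => ?_⟩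
  rcases P with _ | ⟨x, y, hxy⟩
  · change W'.IsInReductionKernel (f 0) ∧
      ‖W'.formalParameter (f 0) - k * W.formalParameter 0‖ ≤ C * ‖W.formalParameter 0‖ ^ 2
    rw [map_zero, W'.formalParameter_zero, W.formalParameter_zero, mul_zero,
      sub_zero, norm_zero, zero_pow two_ne_zero, mul_zero]
    exact ⟨W'.isInReductionKernel_zero, le_rfl⟩
  · obtain ⟨hker, hzle⟩ := hP
    rw [W.isInReductionKernel_some] at hker
    obtain ⟨hy0, hz0, hxn, hyn⟩ := norm_xy_of_one_lt (W := W) hxy.1 hker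
    set t := ‖-x / y‖⁻¹ with ht
    have hzpos : 0 < ‖-x / y‖ := norm_pos_iff.mpr hz0
    have htge : (p : ℝ) ^ N₀ ≤ t := by
      rw [W.formalParameter_some, inv_pow] at hzle
      rw [ht, le_inv_comm₀ (by positivity) hzpos]
      exact hzle
    have ht1 : 1 ≤ t := le_trans (one_le_pow₀ hp1.le) htge
    have hRt : R < t := (le_max_left R T).trans_lt (hN₀.trans_le htge)
    have hTt : T ≤ t := ((le_max_right R T).trans hN₀.le).trans htge
    have hnotBad : Affine.Point.some x y hxy ∉ Bad := fun hmem => by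
      have h1 := hR x y hxy hmem
      have h2 : t ≤ ‖x‖ := by
        rw [hxn, pow_two]; exact le_mul_of_one_le_left (by positivity) ht1
      linarith
    obtain ⟨hb₂x, y', h', hf, hid⟩ := hform₂ x y hxy hnotBad hker
    obtain ⟨-, -, hx'1, -, hest⟩ := hpw x y y' t hTt hxn hyn hxy.1 hb₂x hy0 hid
    rw [hf]
    refine ⟨(W'.isInReductionKernel_some h').mpr hx'1, ?_⟩
    rw [W'.formalParameter_some, W.formalParameter_some]
    calc ‖-(a₂.eval x / b₂.eval x) / y' - k * (-x / y)‖ ≤ C * t⁻¹ ^ 2 := hest hd1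
      _ = C * ‖-x / y‖ ^ 2 := by rw [ht, inv_inv]

end PadicXFormula

end WeierstrassCurve
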